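import Literature.Analysis.UnboundedOperators.LinearizedBoltzmann
import Literature.MathematicalPhysics.KineticTheory.LinearLorentzBoltzmannDuality
import HarnessLib

/-!
# Isotropy of the linearised hard-sphere operator and basis-independence of the Dirichlet sums

Sibling proof file of `LinearizedBoltzmann.lean` (D-0014: named facts `def X : Prop` are
discharged as `theorem X_holds : X`). It discharges

* `Literature.Analysis.UnboundedOperators.viscosityDirichletSum_indep_holds :
  viscosityDirichletSum_indep` — the viscosity Dirichlet sum
  `∑_{i,j} ⟪A_{ij}, (-L)⁻¹ A_{ij}⟫_M = ∑_{i,j} dirichletFormInv hardSphereLinearizedOp (burnettA b i j)`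
  of the linearised hard-sphere operator `L` does not depend on the orthonormal basis `b` used to
  write the Burnett functions `A_{ij}(v) = vᵢ vⱼ - δ_{ij} |v|²/d`;
* `Literature.Analysis.UnboundedOperators.conductivityDirichletSum_indep_holds :
  conductivityDirichletSum_indep` — likewise for the heat-conductivity Dirichlet sum
  `∑_i ⟪B_i, (-L)⁻¹ B_i⟫_M = ∑_i dirichletFormInv hardSphereLinearizedOp (burnettB b i)`,
  `B_i(v) = ½ vᵢ (|v|² - (d + 2))`.

Source / mechanism. Cercignani–Illner–Pulvirenti, *The Mathematical Theory of Dilute Gases*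
(Springer, Applied Mathematical Sciences 106, 1994), §7.1 (1.6), p. 192 (the operator `L`) and
§7.3, proof of Theorem 7.3.6, p. 209: *"the linearized collision operator commutes with any
rotation of `ℝ³`"*. We prove exactly this isotropy, for every linear isometry `R` of the
velocity space and for *every* function `g` (no integrability is needed, since the changes of
variables are measure-preserving bijections and Bochner integrals — including their junk value
`0` — are invariant under them):

* `hardSphereLinearizedOp_comp_linearIsometryEquiv_apply`: `L (g ∘ R) v = (L g)(R v)` — the
  Gaussian `stdGaussian E` is `R`-invariant (Mathlib's `ProbabilityTheory.stdGaussian_map`), the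
  surface measure of the sphere is `R`-invariant
  (`Literature.MathematicalPhysics.KineticTheory.integral_sphere_comp_isometry`), and the
  hard-sphere kernel `((v - v_*)·ω)_+` and the collision map `(v, v_*) ↦ (v', v_*')` are
  `R`-equivariant;
* `maxwellianInner_comp_linearIsometryEquiv`: `⟪g ∘ R, h ∘ R⟫_M = ⟪g, h⟫_M`;
* `dirichletFormInv_comp_linearIsometryEquiv`: the variational form
  `A ↦ ⨆_{g of temperate growth} (2⟪A, g⟫_M + ⟪g, L g⟫_M)` is `R`-invariant, by re-parametrising
  the supremum through the bijection `g ↦ g ∘ R` of `temperateGrowth E`;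
* `burnettA_reindex`, `viscosityDirichletSum_reindex` (`burnettB_reindex`,
  `conductivityDirichletSum_reindex`): re-indexing a basis along `e : ι ≃ ι'` permutes the Burnett
  functions, so the sums are unchanged;
* two orthonormal bases `b, b''` with the same index type differ by the linear isometry
  `R = b''.repr.trans b.repr.symm`, under which `A^{b''}_{ij} = A^{b}_{ij} ∘ R` and
  `B^{b''}_i = B^{b}_i ∘ R` (`burnettA_eq_burnettA_comp`, `burnettB_eq_burnettB_comp`), so the sums
  agree termwise (`viscosityDirichletSum_eq_of_orthonormalBasis`,
  `conductivityDirichletSum_eq_of_orthonormalBasis`); bases with different index types are first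
  re-indexed (`Fintype.card ι = finrank ℝ E = Fintype.card ι'`).

In particular the hypothesis `2 ≤ finrank ℝ E` of the named facts is not needed, and neither are
the (deeper) self-adjointness, non-positivity or spectral-gap properties of `L`: the statements
are pure isotropy. This is the textbook mechanism behind the scalar nature of the Chapman–Enskog
viscosity and heat conductivity (Bardos–Golse–Levermore 1993 §2; CIP 1994 §7.3).

Mathlib anchors: `ProbabilityTheory.stdGaussian_map`, `MeasurePreserving.integral_comp`,
`Function.HasTemperateGrowth.comp`, `ContinuousLinearMap.hasTemperateGrowth`,
`Function.Surjective.iSup_congr`, `OrthonormalBasis.repr_reindex`, `Fintype.sum_equiv`,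
`Fintype.card_eq`, `Module.finrank_eq_card_basis`.
-/

open MeasureTheory Metric ProbabilityTheory Module Set
open scoped InnerProductSpace

namespace Literature.Analysis.UnboundedOperators

open Literature.MathematicalPhysics.KineticTheory

noncomputable section

variable {E : Type*} [NormedAddCommGroup E] [InnerProductSpace ℝ E]

/-! ### Equivariance of the hard-sphere kinematics under linear isometries -/

/-- The hard-sphere kernel is isotropic: `((Rv - Rv_*)·Rω)_+ = ((v - v_*)·ω)_+` for a linear
isometry `R` (here acting on the sphere through its restriction). [folklore] -/
theorem hardSphereKernel_linearIsometryEquiv (A : E ≃ₗᵢ[ℝ] E) (v w : E) (ω : sphere (0 : E) 1) :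
    hardSphereKernel (A v, A w)
        ((mapsTo_sphere_linearIsometryEquiv A).restrict A (sphere (0 : E) 1) (sphere (0 : E) 1) ω) =
      hardSphereKernel (v, w) ω := by
  simp [hardSphereKernel, MapsTo.val_restrict_apply, inner_sub_left,
    LinearIsometryEquiv.inner_map_map]

/-- The elastic collision map is equivariant under linear isometries:
`collide (Rω) (Rv, Rv_*) = (R v', R v_*')`. [folklore] -/
theorem collide_linearIsometryEquiv (A : E ≃ₗᵢ[ℝ] E) (v w : E) (ω : sphere (0 : E) 1) :
    collide ((mapsTo_sphere_linearIsometryEquiv A).restrict A (sphere (0 : E) 1) (sphere (0 : E) 1) ω)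
        (A v, A w) =
      (A (collide ω (v, w)).1, A (collide ω (v, w)).2) := by
  simp [collide, MapsTo.val_restrict_apply, inner_sub_left, LinearIsometryEquiv.inner_map_map,
    map_sub, map_add, map_smul]

/-- Functions of temperate growth are stable under composition with a linear isometry
(Mathlib: `Function.HasTemperateGrowth.comp`, `ContinuousLinearMap.hasTemperateGrowth`).
[folklore] -/
theorem comp_linearIsometryEquiv_mem_temperateGrowth (A : E ≃ₗᵢ[ℝ] E) {g : E → ℝ}
    (hg : g ∈ temperateGrowth E) : g ∘ A ∈ temperateGrowth E := by
  have hA : Function.HasTemperateGrowth (A : E → E) :=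
    (A.toContinuousLinearEquiv : E →L[ℝ] E).hasTemperateGrowth
  exact Function.HasTemperateGrowth.comp hg hA

variable [FiniteDimensional ℝ E] [MeasurableSpace E] [BorelSpace E]

/-! ### Isotropy of the Gaussian pairing and of the linearised hard-sphere operator -/

/-- The standard Gaussian `M(v) dv` is invariant under every linear isometry of `E`
(Mathlib's `ProbabilityTheory.stdGaussian_map`, packaged as `MeasurePreserving`). [folklore] -/
theorem measurePreserving_linearIsometryEquiv_stdGaussian (A : E ≃ₗᵢ[ℝ] E) :
    MeasurePreserving A (stdGaussian E) (stdGaussian E) :=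
  ⟨A.continuous.measurable, stdGaussian_map A⟩

/-- Isotropy of the `L²(M)` pairing: `⟪g ∘ R, h ∘ R⟫_M = ⟪g, h⟫_M` for a linear isometry `R` and
arbitrary `g, h` (change of variables in the Gaussian integral; no integrability needed).
[folklore] -/
theorem maxwellianInner_comp_linearIsometryEquiv (A : E ≃ₗᵢ[ℝ] E) (g h : E → ℝ) :
    maxwellianInner (g ∘ A) (h ∘ A) = maxwellianInner g h := by
  unfold maxwellianInner
  exact (measurePreserving_linearIsometryEquiv_stdGaussian A).integral_comp
    A.toHomeomorph.measurableEmbedding (fun v => g v * h v)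

/-- **The linearised hard-sphere collision operator commutes with rotations** (CIP 1994 §7.3,
proof of Thm 7.3.6, p. 209): `L (g ∘ R) (v) = (L g)(R v)` for every linear isometry `R` of the
velocity space and every `g : E → ℝ`. Proof: substitute `v_* ↦ R v_*` (the Gaussian is
`R`-invariant) and `ω ↦ R ω` (the surface measure is `R`-invariant); the kernel
`((v - v_*)·ω)_+` and the collision map are `R`-equivariant. Both substitutions are
measure-preserving bijections, so no integrability hypothesis is required.
[cite: CIP1994, §7.3 proof of Thm 7.3.6 p. 209] -/
theorem hardSphereLinearizedOp_comp_linearIsometryEquiv_apply (A : E ≃ₗᵢ[ℝ] E) (g : E → ℝ)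
    (v : E) : hardSphereLinearizedOp (g ∘ A) v = hardSphereLinearizedOp g (A v) := by
  simp only [hardSphereLinearizedOp, linearizedCollisionOp]
  refine Eq.trans ?_ ((measurePreserving_linearIsometryEquiv_stdGaussian A).integral_comp
    A.toHomeomorph.measurableEmbedding _)
  congr 1
  funext w
  refine Eq.trans ?_ (integral_sphere_comp_isometry A _)
  congr 1
  funext ω
  rw [hardSphereKernel_linearIsometryEquiv A v w ω, collide_linearIsometryEquiv A v w ω]
  rfl

/-- Function-level form of the isotropy of `L`: `L (g ∘ R) = (L g) ∘ R`.
[cite: CIP1994, §7.3 proof of Thm 7.3.6 p. 209] -/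
theorem hardSphereLinearizedOp_comp_linearIsometryEquiv (A : E ≃ₗᵢ[ℝ] E) (g : E → ℝ) :
    hardSphereLinearizedOp (g ∘ A) = hardSphereLinearizedOp g ∘ A :=
  funext fun v => hardSphereLinearizedOp_comp_linearIsometryEquiv_apply A g v

/-- **Isotropy of the pseudo-inverse form**: for a linear isometry `R`,
`dirichletFormInv L (F ∘ R) = dirichletFormInv L F` for the linearised hard-sphere operator `L`
and every `F : E → ℝ`. Proof: `g ↦ g ∘ R` is a bijection of `temperateGrowth E`, and by the
isotropy of `⟪·, ·⟫_M` and of `L` it carries the variational family of `F` onto that of `F ∘ R`,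
so the two suprema (junk values included) coincide. [folklore] -/
theorem dirichletFormInv_comp_linearIsometryEquiv (A : E ≃ₗᵢ[ℝ] E) (F : E → ℝ) :
    dirichletFormInv hardSphereLinearizedOp (F ∘ A) = dirichletFormInv hardSphereLinearizedOp F := by
  unfold dirichletFormInv
  symm
  refine Function.Surjective.iSup_congr
    (fun g : temperateGrowth E =>
      (⟨(g : E → ℝ) ∘ A, comp_linearIsometryEquiv_mem_temperateGrowth A g.2⟩ : temperateGrowth E))
    ?_ ?_
  · intro g
    refine ⟨⟨(g : E → ℝ) ∘ A.symm, comp_linearIsometryEquiv_mem_temperateGrowth A.symm g.2⟩, ?_⟩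
    apply Subtype.ext
    funext v
    simp
  · intro g
    dsimp only
    rw [hardSphereLinearizedOp_comp_linearIsometryEquiv, maxwellianInner_comp_linearIsometryEquiv,
      maxwellianInner_comp_linearIsometryEquiv]

/-! ### Burnett functions under re-indexing and change of orthonormal basis -/

section Burnett

variable {ι : Type*} [Fintype ι] [DecidableEq ι] {ι' : Type*} [Fintype ι'] [DecidableEq ι']

omit [FiniteDimensional ℝ E] [MeasurableSpace E] [BorelSpace E] in
/-- Re-indexing an orthonormal basis along `e : ι ≃ ι'` permutes the Burnett functions:
`A^{b.reindex e}_{i'j'} = A^{b}_{e⁻¹ i', e⁻¹ j'}`. [folklore] -/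
theorem burnettA_reindex (b : OrthonormalBasis ι ℝ E) (e : ι ≃ ι') (i' j' : ι') :
    burnettA (b.reindex e) i' j' = burnettA b (e.symm i') (e.symm j') := by
  funext v
  simp only [burnettA, OrthonormalBasis.repr_reindex, e.symm.apply_eq_iff_eq]

omit [BorelSpace E] in
/-- The viscosity Dirichlet sum is invariant under re-indexing of the basis (a permutation of the
summands). [folklore] -/
theorem viscosityDirichletSum_reindex (L : (E → ℝ) → E → ℝ) (b : OrthonormalBasis ι ℝ E)
    (e : ι ≃ ι') : viscosityDirichletSum L (b.reindex e) = viscosityDirichletSum L b := by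
  unfold viscosityDirichletSum
  simp_rw [burnettA_reindex]
  exact Fintype.sum_equiv e.symm _ _ fun i' => Fintype.sum_equiv e.symm _ _ fun j' => rfl

omit [FiniteDimensional ℝ E] [MeasurableSpace E] [BorelSpace E] in
/-- Two orthonormal bases `b, b''` of `E` with the same index type differ by the linear isometry
`R = b''.repr.trans b.repr.symm` (`b.repr (R v) = b''.repr v`), and the Burnett functions
transform accordingly: `A^{b''}_{ij} = A^{b}_{ij} ∘ R`. [folklore] -/
theorem burnettA_eq_burnettA_comp (b b'' : OrthonormalBasis ι ℝ E) (i j : ι) :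
    burnettA b'' i j = burnettA b i j ∘ (b''.repr.trans b.repr.symm) := by
  funext v
  have hrepr : b.repr ((b''.repr.trans b.repr.symm) v) = b''.repr v := by simp
  simp only [burnettA, Function.comp_apply, hrepr, LinearIsometryEquiv.norm_map]

/-- The viscosity Dirichlet sum of the linearised hard-sphere operator is the same for any two
orthonormal bases with a common index type (termwise, by isotropy of the pseudo-inverse form).
[folklore] -/
theorem viscosityDirichletSum_eq_of_orthonormalBasis (b b'' : OrthonormalBasis ι ℝ E) :
    viscosityDirichletSum hardSphereLinearizedOp b'' =
      viscosityDirichletSum hardSphereLinearizedOp b := by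
  unfold viscosityDirichletSum
  simp only [burnettA_eq_burnettA_comp b b'', dirichletFormInv_comp_linearIsometryEquiv]

/-- **Discharge** of `viscosityDirichletSum_indep`: the viscosity Dirichlet sum
`∑_{i,j} ⟪A_{ij}, (-L)⁻¹ A_{ij}⟫_M` of the linearised hard-sphere operator does not depend on the
orthonormal basis (nor on its index type). Re-index `b'` along `e : ι ≃ ι'`
(`Fintype.card ι = finrank ℝ E = Fintype.card ι'`), then compare the two `ι`-indexed bases through
the linear isometry between them, using that `L` commutes with rotations (CIP 1994 §7.3, proof
of Thm 7.3.6, p. 209). The dimension hypothesis of the fact is not used.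
[cite: CIP1994, §7.3 proof of Thm 7.3.6 p. 209] -/
theorem viscosityDirichletSum_indep_holds :
    viscosityDirichletSum_indep (E := E) (ι := ι) (ι' := ι') := by
  intro _ b b'
  have hcard : Fintype.card ι = Fintype.card ι' :=
    (Module.finrank_eq_card_basis b.toBasis).symm.trans (Module.finrank_eq_card_basis b'.toBasis)
  obtain ⟨e⟩ : Nonempty (ι ≃ ι') := Fintype.card_eq.1 hcard
  rw [← viscosityDirichletSum_reindex hardSphereLinearizedOp b' e.symm]
  exact (viscosityDirichletSum_eq_of_orthonormalBasis b (b'.reindex e.symm)).symm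

/-! ### The heat-conductivity Dirichlet sum -/

omit [FiniteDimensional ℝ E] [MeasurableSpace E] [BorelSpace E] [DecidableEq ι] [DecidableEq ι'] in
/-- Re-indexing an orthonormal basis along `e : ι ≃ ι'` permutes the heat-flux Burnett functions:
`B^{b.reindex e}_{i'} = B^{b}_{e⁻¹ i'}`. [folklore] -/
theorem burnettB_reindex (b : OrthonormalBasis ι ℝ E) (e : ι ≃ ι') (i' : ι') :
    burnettB (b.reindex e) i' = burnettB b (e.symm i') := by
  funext v
  simp only [burnettB, OrthonormalBasis.repr_reindex]

omit [BorelSpace E] [DecidableEq ι] [DecidableEq ι'] in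
/-- The heat-conductivity Dirichlet sum is invariant under re-indexing of the basis (a permutation
of the summands). [folklore] -/
theorem conductivityDirichletSum_reindex (L : (E → ℝ) → E → ℝ) (b : OrthonormalBasis ι ℝ E)
    (e : ι ≃ ι') : conductivityDirichletSum L (b.reindex e) = conductivityDirichletSum L b := by
  unfold conductivityDirichletSum
  simp_rw [burnettB_reindex]
  exact Fintype.sum_equiv e.symm _ _ fun i' => rfl

omit [FiniteDimensional ℝ E] [MeasurableSpace E] [BorelSpace E] [DecidableEq ι] in
/-- Under the linear isometry `R = b''.repr.trans b.repr.symm` between two orthonormal bases with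
the same index type the heat-flux Burnett functions transform vectorially:
`B^{b''}_i = B^{b}_i ∘ R`. [folklore] -/
theorem burnettB_eq_burnettB_comp (b b'' : OrthonormalBasis ι ℝ E) (i : ι) :
    burnettB b'' i = burnettB b i ∘ (b''.repr.trans b.repr.symm) := by
  funext v
  have hrepr : b.repr ((b''.repr.trans b.repr.symm) v) = b''.repr v := by simp
  simp only [burnettB, Function.comp_apply, hrepr, LinearIsometryEquiv.norm_map]

omit [DecidableEq ι] in
/-- The heat-conductivity Dirichlet sum of the linearised hard-sphere operator is the same for any
two orthonormal bases with a common index type (termwise, by isotropy of the pseudo-inverse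
form). [folklore] -/
theorem conductivityDirichletSum_eq_of_orthonormalBasis (b b'' : OrthonormalBasis ι ℝ E) :
    conductivityDirichletSum hardSphereLinearizedOp b'' =
      conductivityDirichletSum hardSphereLinearizedOp b := by
  unfold conductivityDirichletSum
  simp only [burnettB_eq_burnettB_comp b b'', dirichletFormInv_comp_linearIsometryEquiv]

omit [DecidableEq ι] [DecidableEq ι'] in
/-- **Discharge** of `conductivityDirichletSum_indep`: the heat-conductivity Dirichlet sum
`∑_i ⟪B_i, (-L)⁻¹ B_i⟫_M` of the linearised hard-sphere operator does not depend on the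
orthonormal basis (nor on its index type): re-index `b'` along `e : ι ≃ ι'`, then compare the two
`ι`-indexed bases through the linear isometry between them, using that `L` commutes with rotations
(CIP 1994 §7.3, proof of Thm 7.3.6, p. 209: *"the linearized collision operator commutes with any
rotation"*). The dimension hypothesis of the fact is not used.
[cite: CIP1994, §7.3 proof of Thm 7.3.6 p. 209] -/
theorem conductivityDirichletSum_indep_holds :
    conductivityDirichletSum_indep (E := E) (ι := ι) (ι' := ι') := by
  intro _ b b'
  have hcard : Fintype.card ι = Fintype.card ι' :=
    (Module.finrank_eq_card_basis b.toBasis).symm.trans (Module.finrank_eq_card_basis b'.toBasis)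
  obtain ⟨e⟩ : Nonempty (ι ≃ ι') := Fintype.card_eq.1 hcard
  rw [← conductivityDirichletSum_reindex hardSphereLinearizedOp b' e.symm]
  exact (conductivityDirichletSum_eq_of_orthonormalBasis b (b'.reindex e.symm)).symm

end Burnett

end

end Literature.Analysis.UnboundedOperators
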